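import Summits.ResolutionOfSingularities.KangarooAtlas.MizutaniVectorGroupExponent
import Summits.ResolutionOfSingularities.KangarooAtlas.MizutaniAttainedMultiplicity
import Literature.AlgebraicGeometry.Resolution.HironakaGroupSchemeAdditiveGenerators
import HarnessLib

/-!
# Mizutani's conjecture — Hironaka-side dimension and "`dim B ≤ 2p − 2` ⇒ vector group", UNCONDITIONALLY

Cell topic `Summits/ResolutionOfSingularities/KangarooAtlas` (pub-rosobs); namespace
`Summit.ResolutionOfSingularities.KangarooAtlas.Mizutani`.  AI-written; *AI review is weaker than expert review*; NOT a
resolution theorem, NOT summit progress.  `MizutaniHironakaDimension.lean` / `MizutaniVectorGroup.lean` prove Mizutani's Thm 1.3 on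
Hironaka's side and the named fact `HironakaScheme.Mizutani1973_vectorGroup_of_dim_le` CONDITIONALLY on Hironaka's generation theorem
`HironakaScheme.Hironaka1970_thm1_cor p` ("`U(𝔭)` is generated by additive forms").  That named fact is now a THEOREM of the tree
(`HironakaScheme.Hironaka1970_thm1_cor_holds`, `Literature/…/HironakaGroupSchemeAdditiveGenerators.lean`, cell res-hironaka, librarian
res-D-lib-1), so the hypothesis is discharged here:

* `bIdeal_eq_famIdeal_hirForms_holds`, `ringKrullDim_quotient_bIdeal_holds` — `U_+(𝔭)S` is generated by the additive forms of `U(𝔭)` and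
  `dim B_{P,𝔭} = ringKrullDim (S ⧸ U_+(𝔭)S) = (n+1) − dim_k (U(𝔭) ∩ L)_{e₀}` (Mizutani Thm 1.3, Hironaka's vocabulary), for every point;
* `hsDim_le_ringKrullDim_bIdeal_holds` — Oda's dimension `hsDim 𝔭 ≤ dim B_{P,𝔭}`; `isVectorGroup_of_exponentLE_zero_holds` (exponent 0 ⇒ vector
  group), `finrank_hirForms_eq_of_isVectorGroup_holds`, `isVectorGroup_iff_exponentLE_zero_of_oda` (Mizutani Rem. 1.2 under Oda's equality only);
* `ringKrullDim_quotient_bIdeal_attP` — Mizutani's `H_e` has `dim Spec(S/U_+S) = 2p^e − 1` in Hironaka's vocabulary too, unconditionally;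
* **`mizutani1973_vectorGroup_of_dim_le_holds : Mizutani1973_vectorGroup_of_dim_le p`** — Mizutani 1973 p. 85 (1) / Thm 2.8 in
  Hironaka's multiplicity vocabulary, a theorem of the tree for every prime `p` (from `mizutaniLowerBound`).

What still carries Oda's equality `U(𝔭) ∩ L_e = (L_B)_e` as a hypothesis: `ringKrullDim_quotient_bIdeal_eq_hsDim` (equality of the two
dimensions at points of positive exponent).

References: [Mizutani1973HironakaGroupSchemes] p. 85 (1), Thm. 1.3, Thm. 2.8, Remark 2.10; [Hironaka1970NumericalCharacters] (13.2).
-/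

open MvPolynomial Literature.AlgebraicGeometry.Resolution Literature.AlgebraicGeometry.Resolution.HironakaScheme

namespace Summit.ResolutionOfSingularities.KangarooAtlas.Mizutani

universe u

section Holds

variable (k : Type u) [Field k] (p : ℕ) [hp : Fact p.Prime] [CharP k p] {n : ℕ}
  (𝔭 : Ideal (MvPolynomial (Fin (n + 1)) k))

/-- **`U_+(𝔭)S` is generated by the additive forms of `U(𝔭)`**, for every point (Hironaka's generation theorem discharged by
`Hironaka1970_thm1_cor_holds`). [cite: Mizutani1973HironakaGroupSchemes, Def. 1.1 and p. 85 L26–28] -/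
theorem bIdeal_eq_famIdeal_hirForms_holds [𝔭.IsPrime] (hP : IsPoint k 𝔭) :
    bIdeal k 𝔭 = famIdeal k p (hirForms k p 𝔭) :=
  bIdeal_eq_famIdeal_hirForms k p 𝔭 (Hironaka1970_thm1_cor_holds p) hP

/-- **MIZUTANI'S THEOREM 1.3 in Hironaka's vocabulary, unconditionally**: for a point `𝔭` of `ℙ^n_k`,
`ringKrullDim (S ⧸ U_+(𝔭)S) = (n+1) − dim_k (U(𝔭) ∩ L)_{e₀}` for every level `e₀` from which on `U(𝔭) ∩ L` is generated
(`exists_eventually_eq_span_hirForms`). [cite: Mizutani1973HironakaGroupSchemes, Thm. 1.3] -/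
theorem ringKrullDim_quotient_bIdeal_holds [𝔭.IsPrime] (hP : IsPoint k 𝔭) {e₀ : ℕ}
    (hE : ∀ j, e₀ ≤ j → hirForms k p 𝔭 j ≤
      Submodule.span k (frobVec k p (j - e₀) '' (hirForms k p 𝔭 e₀ : Set (Fin (n + 1) → k)))) :
    ringKrullDim (MvPolynomial (Fin (n + 1)) k ⧸ bIdeal k 𝔭) =
      ((n + 1 - Module.finrank k (hirForms k p 𝔭 e₀) : ℕ) : WithBot ℕ∞) :=
  ringKrullDim_quotient_bIdeal k p 𝔭 (Hironaka1970_thm1_cor_holds p) hP hE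

/-- **Oda's dimension is at most Hironaka's**: `hsDim 𝔭 ≤ ringKrullDim (S ⧸ U_+(𝔭)S)` for every point, unconditionally.
[cite: Mizutani1973HironakaGroupSchemes, Thm. 1.3; Oda1983HironakaGroupSchemeII, §2 (p. 1168)] -/
theorem hsDim_le_ringKrullDim_bIdeal_holds [𝔭.IsPrime] (hP : IsPoint k 𝔭) :
    (hsDim k p 𝔭 : WithBot ℕ∞) ≤ ringKrullDim (MvPolynomial (Fin (n + 1)) k ⧸ bIdeal k 𝔭) :=
  hsDim_le_ringKrullDim_bIdeal k p 𝔭 (Hironaka1970_thm1_cor_holds p) hP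

/-- The two dimensions agree under Oda's equality alone (Hironaka's theorem discharged).
[cite: Mizutani1973HironakaGroupSchemes, Thm. 1.3] -/
theorem ringKrullDim_quotient_bIdeal_eq_hsDim_of_oda [𝔭.IsPrime] (hOda : ∀ e, hirForms k p 𝔭 e = invForms k p 𝔭 e)
    (hP : IsPoint k 𝔭) :
    ringKrullDim (MvPolynomial (Fin (n + 1)) k ⧸ bIdeal k 𝔭) = (hsDim k p 𝔭 : WithBot ℕ∞) :=
  ringKrullDim_quotient_bIdeal_eq_hsDim k p 𝔭 (Hironaka1970_thm1_cor_holds p) hOda hP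

/-- `dim B_{P,𝔭} + 2 ≤ 2p` ⇒ `B_{P,𝔭}` is a vector group, for every point, unconditionally.
[cite: Mizutani1973HironakaGroupSchemes, p. 85 (1), Thm. 2.8] -/
theorem isVectorGroup_of_ringKrullDim_bIdeal_le_holds [𝔭.IsPrime] (hP : IsPoint k 𝔭)
    (hdim : ringKrullDim (MvPolynomial (Fin (n + 1)) k ⧸ bIdeal k 𝔭) + 2 ≤ (2 * p : WithBot ℕ∞)) :
    IsVectorGroup k 𝔭 :=
  isVectorGroup_of_ringKrullDim_bIdeal_le' k p 𝔭 (Hironaka1970_thm1_cor_holds p) hP hdim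


/-- A vector group has Hironaka-exponent `0` (all levels of `U(𝔭) ∩ L` have the same dimension), unconditionally.
[cite: Mizutani1973HironakaGroupSchemes, Rem. 1.2 (p. 86)] -/
theorem finrank_hirForms_eq_of_isVectorGroup_holds [𝔭.IsPrime] (hP : IsPoint k 𝔭) (hV : IsVectorGroup k 𝔭) (j : ℕ) :
    Module.finrank k (hirForms k p 𝔭 j) = Module.finrank k (hirForms k p 𝔭 0) :=
  finrank_hirForms_eq_of_isVectorGroup k p 𝔭 (Hironaka1970_thm1_cor_holds p) hP hV j

/-- **Mizutani's Remark 1.2 under Oda's equality alone**: `IsVectorGroup k 𝔭 ↔ ExponentLE k p 𝔭 0`.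
[cite: Mizutani1973HironakaGroupSchemes, Rem. 1.2 (p. 86)] -/
theorem isVectorGroup_iff_exponentLE_zero_of_oda [𝔭.IsPrime] (hOda : ∀ e, hirForms k p 𝔭 e = invForms k p 𝔭 e)
    (hP : IsPoint k 𝔭) : IsVectorGroup k 𝔭 ↔ ExponentLE k p 𝔭 0 :=
  isVectorGroup_iff_exponentLE_zero k p 𝔭 (Hironaka1970_thm1_cor_holds p) hOda hP

/-- `exponent B(𝔭) = 0` (Oda) ⇒ vector group (Hironaka), unconditionally (no Oda hypothesis: it holds at such points).
[cite: Mizutani1973HironakaGroupSchemes, Rem. 1.2 (p. 86)] -/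
theorem isVectorGroup_of_exponentLE_zero_holds [𝔭.IsPrime] (hP : IsPoint k 𝔭) (h0 : ExponentLE k p 𝔭 0) :
    IsVectorGroup k 𝔭 :=
  isVectorGroup_of_exponentLE_zero' k p 𝔭 (Hironaka1970_thm1_cor_holds p) hP h0

end Holds


section MizutaniPoint

variable {F : Type u} [Field F] {p e : ℕ} [hp : Fact p.Prime] [CharP F p]

/-- **Mizutani's extremal scheme `H_e` has dimension `2p^e − 1` ALSO as Hironaka's `Spec(S/U_+S)`**: for the point `attP F p e`
of `ℙ^{2p^e−1}` over `F(u_0,u_1)` (`F` with `c^p = c`, `e ≥ 1`; encloser-1's `MizutaniAttainedPoint.lean`),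
`ringKrullDim (S ⧸ bIdeal (attP)) + 1 = 2p^e`, unconditionally: Oda's equality holds at this point (`hirForms_attP_eq`, encloser-1 g3)
and Hironaka's generation theorem is `Hironaka1970_thm1_cor_holds`. [cite: Mizutani1973HironakaGroupSchemes, Remark 2.10 (dim H_e = 2p^e − 1) and Def. 1.1] -/
theorem ringKrullDim_quotient_bIdeal_attP (hF : ∀ c : F, c ^ p = c) (he : 1 ≤ e) :
    ringKrullDim (MvPolynomial (Fin (attN p e + 1)) (RatField F 2) ⧸ bIdeal (RatField F 2) (attP F p e)) + 1 =
      (2 * p ^ e : WithBot ℕ∞) := by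
  haveI : (attP F p e).IsPrime := attP_isPrime
  rw [ringKrullDim_quotient_bIdeal_eq_hsDim_of_oda (RatField F 2) p (attP F p e) (fun j => hirForms_attP_eq hF he j)
    isPoint_attP, ← hsDimAt_eq_hsDim (RatField F 2) p (attP F p e) (exponentLE_attP hF he)]
  have h := hsDimAt_attP (F := F) hF he
  exact_mod_cast h

end MizutaniPoint

/-- **MIZUTANI 1973, p. 85 (1) / THEOREM 2.8, in Hironaka's multiplicity vocabulary — a theorem of the tree**: the named fact
`HironakaScheme.Mizutani1973_vectorGroup_of_dim_le p` ("for a point `𝔭` of `ℙⁿ_k`, `char k = p`: if `dim B_{P,𝔭} ≤ 2p − 2` then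
`B_{P,𝔭} = Spec(S/U_+(𝔭)S)` is a vector group") HOLDS for every prime `p`: the pub-rosobs enclosure's `mizutaniLowerBound`
(`m(e) ≥ 2p^e − 1` in Oda's description) + the dimension bridge (`MizutaniHironakaDimension.lean`) + encloser-1's
`hirForms_le_invForms` / `hirForms_eq_invForms_of_exponentLE_zero` + res-hironaka's `Hironaka1970_thm1_cor_holds`.
AI-written; *AI review is weaker than expert review*. [cite: Mizutani1973HironakaGroupSchemes, p. 85 L12–L18 (1), Thm. 2.8 p. 90] -/
theorem mizutani1973_vectorGroup_of_dim_le_holds (p : ℕ) [Fact p.Prime] : Mizutani1973_vectorGroup_of_dim_le.{u} p :=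
  mizutani1973_vectorGroup_of_dim_le_of_hironaka p (Hironaka1970_thm1_cor_holds p)

end Summit.ResolutionOfSingularities.KangarooAtlas.Mizutani
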